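import Summits.CriticalPhenomena.PercolationContinuityZ3.Theses.PercReliabilityThinning
import Literature.Probability.Percolation.SusceptibilityGammaOne

/-!
# Line `birth` — registered skeleton (BC3) for the crux `NuSupLtOne` (stmt-CriticalPhenomena-11744)

Crux (FIXED; rank 2 of `route-CriticalPhenomena-PercReliabilityThinning`, sub-problem
`PercolationContinuityZ3`; decl
`Summit.CriticalPhenomena.PercolationContinuityZ3.Theses.PercReliabilityThinning.NuSupLtOne`):
`∃ ν' < 1, C > 0, δ₀ > 0 : ∀ p ∈ (p_c − δ₀, p_c), ∀ n, P_p(0 ↔ n e₁) ≤ exp(−(p_c − p)^{ν'} n / C)` —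
`ν_sup < 1` for the axis correlation length of bond percolation on `ℤ³` (`ξ(p) ≤ C (p_c − p)^{−ν'}`,
Grimmett 1999 Thm (6.44)). Numerics `ν = 0.8764(12)` (arXiv:1302.0421); rigorous state of the art
`ξ(p_c − δ) ≤ exp(C δ^{−2})` (DuminilcopinKozmaTassion2020 Thm 2, arXiv:1902.03207).

## The cut — Fisher's relation `ν = γ / (2 − η) < 1` through Hammersley's finite-size criterion

Write `a_p(L) := P_p(0 ↔ ∂Λ_L in Λ_L)` (the one-arm event `siteToBoundary 3 L`),
`M_p(n) := Σ_{x ∈ Λ_n} τ_p(0, x)` (two-point mass of the box, `tau`, `box`) and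
`χ(p) = Σ_x τ_p(0, x)` (`chi 3 p`; summable for `p < p_c`, `summable_tau_of_lt_criticalProb`, so
`M_p(n) ≤ χ(p)`). CRITERION at scale `L`: `(2L+1)³ · a_p(L) ≤ 1/2`.

* S1 `stub_criterionDecay` — HAMMERSLEY'S FINITE-SIZE CRITERION GIVES UNIFORM AXIS DECAY AT RATE
  `≍ 1/L` (M/L, PROVABLE NOW): `∃ K > 0 : ∀ p < p_c(ℤ³), ∀ L ≥ 1`, if `(2L+1)³ a_p(L) ≤ 1/2` then
  `P_p(0 ↔ n e₁) ≤ exp(−n / (K L))` for EVERY `n ∈ ℕ`. Paper proof: `τ_p(0, x) ≤ a_p(L)` for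
  `‖x‖_∞ = L`, so `Σ_{x ∈ ∂Λ_L} τ_p(0,x) ≤ (2L+1)³ a_p(L) ≤ 1/2`; the BK/Hammersley iteration
  `a_p(m + k) ≤ Σ_{x ∈ ∂Λ_m} τ_p(0, x) · a_p(k)` (Grimmett 1999 §6.1, proof of Thm (6.1),
  eqs (6.7)–(6.8), book pp. 119–120 — read in the held copy) gives `a_p(jL) ≤ 2^{−j}`, hence for
  `n ≥ L`: `P_p(0 ↔ ne₁) ≤ a_p(⌊n/L⌋ L) ≤ 2^{−⌊n/L⌋} ≤ exp(−(log 2) n / (2L))`; for `1 ≤ n < L`: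
  `P_p(0 ↔ ne₁) ≤ a_p(1) = 1 − (1 − p)⁶ ≤ 1 − (1 − p_c)⁶ =: e^{−κ} ≤ e^{−n/(KL)}` once `K ≥ 1/κ`
  (`0 < p_c(ℤ³) < 1` in tree: `criticalProb_zd_pos`, `criticalProb_zd_lt_one`); `n = 0` is `1 ≤ 1`.
  So `K := max(2 / log 2, 1/κ)` works. A theorem of the real world, not the crux: it says nothing
  about WHERE the criterion holds.
* S2 `stub_chiUpperGammaTwo` — SUSCEPTIBILITY EXPONENT BOUND `γ' = 2` (OPEN): `∃ C : ∀ p < p_c(ℤ³)`,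
  `χ(p) · (p_c − p)² ≤ C`. VERBATIM the registered stub `stub_chiUpperGammaTwo` of the sister
  skeleton `Cruxes/Z3SubcritLengthExponent/Lines/birth.lean` (stmt-CriticalPhenomena-6529, the
  `ν < 6/5` crux of PercLoopDislocationCovers): ONE proof closes both. Truth `γ = 1.79` (margin
  `0.21`); rigorous: only `γ ≥ 1` (AizenmanNewman1984, Grimmett 1999 §10.2). The threshold `2` is
  forced, not picked: `γ' < 2` would contradict a jump world (`θ(p_c) > 0 ⇒ δ = ∞ ⇒ γ ≥ 2`,
  Newman1986 / Newman 1987c `γ ≥ 2(1 − 1/δ)`, Grimmett 1999 p. 278) and so be summit-strength by a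
  known theorem; `γ' = 2` is jump-compatible, hence NOT the conjunct in disguise.
* S3 `stub_massPlateauAboveTwo` — QUASI-CRITICAL MASS PLATEAU WITH EXPONENT `a > 2`, i.e. `η < 0`
  (OPEN, LOAD-BEARING): `∃ a > 2, c > 0 : ∀ p < p_c, ∀ n ≥ 1` at which the criterion FAILS,
  `(2n+1)³ a_p(n) > 1/2`, one has `M_p(n) ≥ c n^a`. Scaling picture: failure forces
  `n ≲ ξ(p) log ξ(p)`, where `M_p(n) ≍ min(n, ξ)^{2−η}` and `2 − η = γ/ν = 2.0459(2)`
  (`η(ℤ³) = −0.0459`, arXiv:1302.0421 / Xu–Wang–Lv–Deng 2014 `d_f = 2.52293(10)`): margin `0.046`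
  in the exponent, the `log` absorbed by it (binding regime `ln ξ ≈ 80`, `c ≈ 10⁻⁴` of the
  amplitude for `a = 2.02`). It is the `a > 2` strengthening of the sister's registered
  `stub_quasicriticalMass` (`a > 5/3`): a proof of S3 closes that stub too. Kesten-1987-type
  stability "below the finite-size length arm/connectivity probabilities are comparable to critical
  ones" plus `η < 0` at `p_c`; rigorous floor `M_{p_c}(n) ≥ c n` (`φ_{p_c}(Λ_n) ≥ 1`,
  DuminilCopinTassionCMP2016). In a jump world S3 holds with room (`τ_{p_c} ≥ θ²` gives `a` up to 3).
  Why it might fail: `η < 0` is a percolation-specific numerical fact (it violates the would-be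
  infrared bound `η ≥ 0` of reflection-positive models) with no rigorous support in `d = 3`, and the
  uniformity up to the criterion scale `≈ ξ log ξ` (not just `ξ`) is a near-critical stability
  statement with no RSW in `d = 3`.

`NuSupLtOne_of` (kernel-checked, no `sorry` of its own; ~70 lines of real analysis): from S2, S3
get `a > 2`, `c`, `C₁`; put `ν' := 2/a < 1`, `C' := max C₁ 1`, `K₀ := (C'/c)^{1/a}`,
`C := K (K₀ + 1)`, `δ₀ := 1`. For `p < p_c` let `ε := p_c − p ∈ (0, 1]` and
`L := ⌊K₀ ε^{−2/a}⌋ + 1` (so `K₀ ε^{−2/a} < L ≤ K₀ ε^{−2/a} + 1`). If the criterion FAILED at `L`,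
S3, `M_p(L) ≤ χ(p)` and S2 give `c L^a ε² ≤ C'`, whereas `L > K₀ ε^{−2/a}` gives
`c L^a ε² > C'` — so the criterion HOLDS at `L`, and S1 yields, for every `n`,
`P_p(0 ↔ ne₁) ≤ exp(−n/(KL)) ≤ exp(−ε^{2/a} n / (K (K₀+1)))` because `L ε^{2/a} ≤ K₀ + 1`.
Hypotheses = the three stubs under their registered names (`Registered.stub_*` aliases, the device
of the sister skeletons: the native audit admits a hypothesis iff its head constant is NAMED like a
declared stub); conclusion = the route decl BY NAME.

BC3 probes (files `bc/probe_<stub>.lean` of the registering seat, 2026-08-17): for each of the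
three stubs, `stub → NuSupLtOne` and `stub → PercolationContinuityZ3` by
`first | exact? | simpa [S] | (unfold S; simpa) | aesop` FAIL (6/6) — no stub is cheaply the crux
or the conjunct. Independence: S1 is a theorem about every `p` (provable now) and cannot give an
exponent; S2 alone gives only `ξ ≲ χ ≲ ε^{−2}` (Simon–Lieb), exponent `2`, not `< 1`; S3 alone is a
lower bound on connectivity; the crux gives neither S2 (from `ξ ≲ ε^{−ν'}` only `χ ≲ ε^{−3ν'}`)
nor S3.

All three stubs are stated in TREE VOCABULARY ONLY, fully qualified (`criticalProb`, `zdGraph`,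
`bondPercolation`, `siteToBoundary`, `openConn`, `chi`, `tau`, `box`), so each lands verbatim as
`Theorems/PercReliabilityThinningNuSupLtOne<Stub>.lean --supports stmt-CriticalPhenomena-11744`.
Disproof used: none relevant — no `Disproof.lean`, no `Negative/` lemma exists for this crux at
registration (`ledger crux ls stmt-CriticalPhenomena-11744`: no workfiles, 2026-08-17); negatives
index of the summit (11 entries, 2026-08-17): nothing on `χ`, `ξ`, one-arm criteria or exponents
(stmt-7073, the only `box 3 R` entry, is a p-uniform in-box bound; every statement here is at fixed
`p < p_c`). Degenerate instances excluded by typing: `n = 0` in S1 reads `1 ≤ exp 0`; the base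
`p_c − p` of every real power lies in `(0, 1]`, so no `rpow` junk; `1 ≤ n`/`1 ≤ L` exclude the
trivial scale; `χ`'s junk value `0` at `p ≥ p_c` is never met (`p < p_c` throughout).
-/

noncomputable section

open Literature.Probability.Percolation Literature.Probability.LatticeModels

namespace Summit.CriticalPhenomena.PercolationContinuityZ3.Cruxes.NuSupLtOne.Birth

/-! ### The three statements, named (proof-side abbreviations; the stubs themselves inline everything) -/

/-- **S1, named.** Hammersley's finite-size criterion at scale `L` gives axis decay at rate
`1/(K L)` for every distance `n`, uniformly in `p < p_c(ℤ³)`. -/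
def CriterionDecay : Prop :=
  ∃ K : ℝ, 0 < K ∧ ∀ p : unitInterval,
    (p : ℝ) < Literature.Probability.Percolation.criticalProb (Literature.Probability.LatticeModels.zdGraph 3) 0 →
      ∀ L : ℕ, 1 ≤ L →
        ((2 * L + 1) ^ 3 : ℝ) *
            (Literature.Probability.Percolation.bondPercolation (Literature.Probability.LatticeModels.zdGraph 3) p).real
              (Literature.Probability.Percolation.siteToBoundary 3 L) ≤ 1 / 2 →
          ∀ n : ℕ,
            (Literature.Probability.Percolation.bondPercolation (Literature.Probability.LatticeModels.zdGraph 3) p).real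
                (Literature.Probability.Percolation.openConn (0 : Fin 3 → ℤ) (Pi.single 0 (n : ℤ))) ≤
              Real.exp (-((n : ℝ) / (K * L)))

/-- **S2, named.** Susceptibility exponent bound `γ' = 2` on `ℤ³`: `χ(p) (p_c − p)² ≤ C` below `p_c`. -/
def ChiUpperGammaTwo : Prop :=
  ∃ C : ℝ, ∀ p : unitInterval,
    (p : ℝ) < Literature.Probability.Percolation.criticalProb (Literature.Probability.LatticeModels.zdGraph 3) 0 →
      Literature.Probability.Percolation.chi 3 p *
          (Literature.Probability.Percolation.criticalProb (Literature.Probability.LatticeModels.zdGraph 3) 0 - p) ^ 2 ≤ C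

/-- **S3, named.** Quasi-critical mass plateau with exponent above two: at every subcritical `p`
and every scale `n ≥ 1` where the criterion fails, `Σ_{x ∈ Λ_n} τ_p(0,x) ≥ c n^a`, some `a > 2`. -/
def MassPlateauAboveTwo : Prop :=
  ∃ a c : ℝ, 2 < a ∧ 0 < c ∧ ∀ p : unitInterval,
    (p : ℝ) < Literature.Probability.Percolation.criticalProb (Literature.Probability.LatticeModels.zdGraph 3) 0 →
      ∀ n : ℕ, 1 ≤ n →
        1 / 2 < ((2 * n + 1) ^ 3 : ℝ) *
            (Literature.Probability.Percolation.bondPercolation (Literature.Probability.LatticeModels.zdGraph 3) p).real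
              (Literature.Probability.Percolation.siteToBoundary 3 n) →
          c * (n : ℝ) ^ a ≤ ∑ x ∈ Literature.Probability.LatticeModels.box 3 n, Literature.Probability.Percolation.tau 3 p 0 x

/-! ### The stubs (the ONLY `sorry`s of this file) -/

/-- **S1 — Hammersley's finite-size criterion gives uniform axis decay (bond percolation on `ℤ³`).**
There is `K > 0` such that for every `p < p_c(ℤ³)`, every `L ≥ 1` with
`(2L+1)³ · P_p(0 ↔ ∂Λ_L in Λ_L) ≤ 1/2`, and EVERY `n`, `P_p(0 ↔ n e₁) ≤ exp(−n/(K L))`.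
Grimmett 1999 §6.1 (6.7)–(6.8) (BK iteration, Hammersley 1957a) for `n ≥ L`; the isolation bound
`P_p(0 ↔ ne₁) ≤ 1 − (1−p)⁶ ≤ 1 − (1−p_c)⁶ < 1` for `1 ≤ n < L`. Size: M/L, provable now. -/
theorem stub_criterionDecay :
    ∃ K : ℝ, 0 < K ∧ ∀ p : unitInterval,
    (p : ℝ) < Literature.Probability.Percolation.criticalProb (Literature.Probability.LatticeModels.zdGraph 3) 0 →
      ∀ L : ℕ, 1 ≤ L →
        ((2 * L + 1) ^ 3 : ℝ) *
            (Literature.Probability.Percolation.bondPercolation (Literature.Probability.LatticeModels.zdGraph 3) p).real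
              (Literature.Probability.Percolation.siteToBoundary 3 L) ≤ 1 / 2 →
          ∀ n : ℕ,
            (Literature.Probability.Percolation.bondPercolation (Literature.Probability.LatticeModels.zdGraph 3) p).real
                (Literature.Probability.Percolation.openConn (0 : Fin 3 → ℤ) (Pi.single 0 (n : ℤ))) ≤
              Real.exp (-((n : ℝ) / (K * L))) := by
  sorry

/-- **S2 — susceptibility exponent bound `γ' = 2` (bond percolation on `ℤ³`, subcritical).** There is
`C` such that `χ(p) · (p_c − p)² ≤ C` for every `p < p_c(ℤ³)`, `χ(p) = Σ_x τ_p(0,x)`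
(`Literature.Probability.Percolation.chi`). Truth `γ ≈ 1.79`; known: `γ ≥ 1` only
(AizenmanNewman1984); no polynomial upper bound on `χ` is known in `d = 3`; `2` is the jump-compatible
threshold (Newman1986). Verbatim the registered stub of stmt-CriticalPhenomena-6529. Size: open (L+). -/
theorem stub_chiUpperGammaTwo :
    ∃ C : ℝ, ∀ p : unitInterval,
    (p : ℝ) < Literature.Probability.Percolation.criticalProb (Literature.Probability.LatticeModels.zdGraph 3) 0 →
      Literature.Probability.Percolation.chi 3 p *
          (Literature.Probability.Percolation.criticalProb (Literature.Probability.LatticeModels.zdGraph 3) 0 - p) ^ 2 ≤ C := by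
  sorry

/-- **S3 — quasi-critical mass plateau with exponent above two (`η < 0`), LOAD-BEARING.** There are
`a > 2` and `c > 0` such that for every `p < p_c(ℤ³)` and every `n ≥ 1` at which the finite-size
criterion fails, `(2n+1)³ · P_p(0 ↔ ∂Λ_n in Λ_n) > 1/2`, the two-point mass satisfies
`Σ_{x ∈ Λ_n} τ_p(0, x) ≥ c · n^a`. Kesten-1987-type stability below the finite-size length plus
`2 − η = 2.0459(2) > 2` at `p_c` (arXiv:1302.0421); rigorous floor `Σ_{Λ_n} τ_{p_c} ≥ c n`.
The `a > 2` strengthening of the registered `stub_quasicriticalMass` (`a > 5/3`) of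
stmt-CriticalPhenomena-6529. Size: open (L+). -/
theorem stub_massPlateauAboveTwo :
    ∃ a c : ℝ, 2 < a ∧ 0 < c ∧ ∀ p : unitInterval,
    (p : ℝ) < Literature.Probability.Percolation.criticalProb (Literature.Probability.LatticeModels.zdGraph 3) 0 →
      ∀ n : ℕ, 1 ≤ n →
        1 / 2 < ((2 * n + 1) ^ 3 : ℝ) *
            (Literature.Probability.Percolation.bondPercolation (Literature.Probability.LatticeModels.zdGraph 3) p).real
              (Literature.Probability.Percolation.siteToBoundary 3 n) →
          c * (n : ℝ) ^ a ≤ ∑ x ∈ Literature.Probability.LatticeModels.box 3 n, Literature.Probability.Percolation.tau 3 p 0 x := by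
  sorry

/-! ### Consistency: each named statement IS its registered stub (definitionally) -/

theorem criterionDecay_holds : CriterionDecay := stub_criterionDecay
theorem chiUpperGammaTwo_holds : ChiUpperGammaTwo := stub_chiUpperGammaTwo
theorem massPlateauAboveTwo_holds : MassPlateauAboveTwo := stub_massPlateauAboveTwo

/-! ### Name-keyed aliases of the three statements — the hypotheses of `NuSupLtOne_of`

The native skeleton audit (`#h21_check_skeleton`) admits a hypothesis of the skeleton theorem only if
its head constant is a registered obligation or is NAMED like a declared stub; `Registered.stub_X` is
the statement of `stub_X` under that name, `rfl`-equal to it. -/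
namespace Registered

/-- Alias of `CriterionDecay` keyed by the registered stub name. -/
abbrev stub_criterionDecay : Prop := CriterionDecay
/-- Alias of `ChiUpperGammaTwo` keyed by the registered stub name. -/
abbrev stub_chiUpperGammaTwo : Prop := ChiUpperGammaTwo
/-- Alias of `MassPlateauAboveTwo` keyed by the registered stub name. -/
abbrev stub_massPlateauAboveTwo : Prop := MassPlateauAboveTwo

end Registered

/-! ### The skeleton theorem: the three stubs imply the crux, BY NAME -/

/-- **`NuSupLtOne` from the line `birth`** (kernel-checked, no `sorry` of its own). With `K` from
S1, `C₁` from S2 and `a > 2`, `c > 0` from S3 put `ν' := 2/a < 1`, `C' := max C₁ 1`,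
`K₀ := (C'/c)^{1/a}`, `C := K (K₀ + 1)`, `δ₀ := 1`. For `p < p_c` let `ε := p_c − p ∈ (0, 1]` and
`L := ⌊K₀ ε^{−2/a}⌋₊ + 1`. If the criterion failed at `L`, S3 and `M_p(L) ≤ χ(p)` and S2 give
`c L^a ε² ≤ C'`; but `L > K₀ ε^{−2/a}` gives `L^a > (C'/c) ε^{−2}`, i.e. `c L^a ε² > C'` —
contradiction. So the criterion holds at `L`, and S1 gives, for every `n`,
`P_p(0 ↔ ne₁) ≤ exp(−n/(KL)) ≤ exp(−ε^{2/a} n / C)` since `L ε^{2/a} ≤ K₀ + 1`. -/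
theorem NuSupLtOne_of (h₁ : Registered.stub_criterionDecay) (h₂ : Registered.stub_chiUpperGammaTwo)
    (h₃ : Registered.stub_massPlateauAboveTwo) :
    Summit.CriticalPhenomena.PercolationContinuityZ3.Theses.PercReliabilityThinning.NuSupLtOne := by
  obtain ⟨K, hK, hdec⟩ := h₁
  obtain ⟨C₁, hC₁⟩ := h₂
  obtain ⟨a, c, ha, hc, hmass⟩ := h₃
  have ha0 : 0 < a := by linarith
  set C' : ℝ := max C₁ 1 with hC'_def
  have hC'1 : 1 ≤ C' := le_max_right _ _
  have hC'0 : 0 < C' := by linarith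
  set K₀ : ℝ := (C' / c) ^ (1 / a) with hK₀_def
  have hK₀ : 0 ≤ K₀ := Real.rpow_nonneg (div_pos hC'0 hc).le _
  have hKK : 0 < K * (K₀ + 1) := mul_pos hK (by linarith)
  refine ⟨2 / a, (div_lt_one ha0).2 ha, K * (K₀ + 1), hKK, 1, one_pos, ?_⟩
  intro p _ hp n
  simp only [Literature.Probability.Percolation.coe_criticalProbI] at hp ⊢
  set pc : ℝ := Literature.Probability.Percolation.criticalProb
    (Literature.Probability.LatticeModels.zdGraph 3) (0 : Site 3) with hpc_def
  have hε : 0 < pc - (p : ℝ) := sub_pos.2 hp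
  have hε1 : pc - (p : ℝ) ≤ 1 := by
    have h1 : pc ≤ 1 := (criticalProb_mem_Icc (zdGraph 3) (0 : Site 3)).2
    have h2 : (0 : ℝ) ≤ (p : ℝ) := p.2.1
    linarith
  have hεν : 0 < (pc - (p : ℝ)) ^ (-(2 / a)) := Real.rpow_pos_of_pos hε _
  -- the scale `L := ⌊K₀ ε^{-2/a}⌋₊ + 1`
  set T : ℝ := K₀ * (pc - (p : ℝ)) ^ (-(2 / a)) with hT_def
  have hT0 : 0 ≤ T := mul_nonneg hK₀ hεν.le
  set L : ℕ := ⌊T⌋₊ + 1 with hL_def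
  have hL1 : 1 ≤ L := by rw [hL_def]; omega
  have hTL : T < (L : ℝ) := by
    rw [hL_def]; push_cast; exact Nat.lt_floor_add_one T
  have hLT : (L : ℝ) ≤ T + 1 := by
    rw [hL_def]; push_cast; linarith [Nat.floor_le hT0]
  have hLpos : (0 : ℝ) < L := by exact_mod_cast hL1
  -- the finite-size criterion HOLDS at scale `L` (else S3 + `M ≤ χ` + S2 contradict `L > K₀ ε^{-2/a}`)
  have hcrit : ((2 * L + 1) ^ 3 : ℝ) *
      (bondPercolation (zdGraph 3) p).real (siteToBoundary 3 L) ≤ 1 / 2 := by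
    by_contra hfail
    rw [not_le] at hfail
    have hm := hmass p hp L hL1 hfail
    have hsum : ∑ x ∈ box 3 L, tau 3 p 0 x ≤ chi 3 p := by
      rw [chi_def]
      exact (summable_tau_of_lt_criticalProb (d := 3) (by norm_num) p hp).sum_le_tsum _
        (fun x _ => tau_nonneg p 0 x)
    have hchi : chi 3 p * (pc - p) ^ 2 ≤ C' := (hC₁ p hp).trans (le_max_left _ _)
    have hε2 : 0 < (pc - (p : ℝ)) ^ 2 := pow_pos hε 2
    have h1 : c * (L : ℝ) ^ a * (pc - p) ^ 2 ≤ C' :=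
      (mul_le_mul_of_nonneg_right (hm.trans hsum) hε2.le).trans hchi
    have h3 : (K₀ * (pc - (p : ℝ)) ^ (-(2 / a))) ^ a < (L : ℝ) ^ a :=
      Real.rpow_lt_rpow (mul_nonneg hK₀ hεν.le) hTL ha0
    have hKa : K₀ ^ a = C' / c := by
      rw [hK₀_def, ← Real.rpow_mul (div_pos hC'0 hc).le, one_div_mul_cancel ha0.ne', Real.rpow_one]
    have hεa : ((pc - (p : ℝ)) ^ (-(2 / a))) ^ a = ((pc - (p : ℝ)) ^ 2)⁻¹ := by
      rw [← Real.rpow_mul hε.le, show (-(2 / a)) * a = -(2 : ℝ) by field_simp, Real.rpow_neg hε.le,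
        Real.rpow_two]
    rw [Real.mul_rpow hK₀ hεν.le, hKa, hεa] at h3
    have h4 : C' < c * (L : ℝ) ^ a * (pc - p) ^ 2 := by
      have h5 := mul_lt_mul_of_pos_right h3 (mul_pos hc hε2)
      have hl : C' / c * ((pc - (p : ℝ)) ^ 2)⁻¹ * (c * (pc - (p : ℝ)) ^ 2) = C' := by
        field_simp
      have hr : (L : ℝ) ^ a * (c * (pc - (p : ℝ)) ^ 2) = c * (L : ℝ) ^ a * (pc - p) ^ 2 := by ring
      rw [hl, hr] at h5
      exact h5
    linarith
  -- S1 at scale `L`, then `L ε^{2/a} ≤ K₀ + 1`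
  have hd := hdec p hp L hL1 hcrit n
  refine hd.trans ?_
  rw [Real.exp_le_exp, neg_le_neg_iff]
  have hLε : (L : ℝ) * (pc - (p : ℝ)) ^ (2 / a) ≤ K₀ + 1 := by
    have hεle : (pc - (p : ℝ)) ^ (2 / a) ≤ 1 := Real.rpow_le_one hε.le hε1 (by positivity)
    have hε0 : 0 ≤ (pc - (p : ℝ)) ^ (2 / a) := Real.rpow_nonneg hε.le _
    have hprod : (pc - (p : ℝ)) ^ (-(2 / a)) * (pc - (p : ℝ)) ^ (2 / a) = 1 := by
      rw [← Real.rpow_add hε, neg_add_cancel, Real.rpow_zero]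
    calc (L : ℝ) * (pc - (p : ℝ)) ^ (2 / a) ≤ (T + 1) * (pc - (p : ℝ)) ^ (2 / a) :=
          mul_le_mul_of_nonneg_right hLT hε0
      _ = K₀ * ((pc - (p : ℝ)) ^ (-(2 / a)) * (pc - (p : ℝ)) ^ (2 / a)) + (pc - (p : ℝ)) ^ (2 / a) := by
          rw [hT_def]; ring
      _ = K₀ + (pc - (p : ℝ)) ^ (2 / a) := by rw [hprod, mul_one]
      _ ≤ K₀ + 1 := by linarith
  have hn : (0 : ℝ) ≤ n := Nat.cast_nonneg n
  rw [div_le_div_iff₀ hKK (mul_pos hK hLpos)]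
  calc (pc - (p : ℝ)) ^ (2 / a) * (n : ℝ) * (K * L)
      = (n : ℝ) * K * ((L : ℝ) * (pc - (p : ℝ)) ^ (2 / a)) := by ring
    _ ≤ (n : ℝ) * K * (K₀ + 1) := mul_le_mul_of_nonneg_left hLε (mul_nonneg hn hK.le)
    _ = (n : ℝ) * (K * (K₀ + 1)) := by ring

/-- Wiring check (an `example`, so that `NuSupLtOne_of` stays the only theorem concluding the crux):
the registered stubs, with their tree-vocabulary types, feed the skeleton theorem as stated — this
term becomes the crux proof when the three `sorry`s above are discharged. -/
example : Summit.CriticalPhenomena.PercolationContinuityZ3.Theses.PercReliabilityThinning.NuSupLtOne :=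
  NuSupLtOne_of stub_criterionDecay stub_chiUpperGammaTwo stub_massPlateauAboveTwo

end Summit.CriticalPhenomena.PercolationContinuityZ3.Cruxes.NuSupLtOne.Birth

end
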